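import Summits.ValiantsHypothesis.ValiantsHypothesis.Theorems.LacunarySymmetroidMatrixDescartesCensusDoorA34SheetTwistedBlocks
import Summits.ValiantsHypothesis.ValiantsHypothesis.Theorems.LacunarySymmetroidMatrixDescartesCensusDoorA34IsotropicTangentCentre

/-!
# `MatrixDescartes` census — DOOR A at `(3,4)`: the FOUR TWISTED LETTER TRINOMIALS of a nineteen (and of a null-top eighteen) satisfy the
# two-root AM–GM inequality — the `(1,3)`-windows `{k,k,j}` beside the `(2,3)`-windows `{k,i,j}` of …TwistedLetterWindows / …SheetTwistedLetterWindows

HONEST FRAMING.  Object-search cell `pub-symmetroid`, engine seat `val-sym-eng-2` (g12); helper rows `--supports` the OPEN typed statement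
`Theses.LacunarySymmetroid.DoorA34 = PosRootLawAt 3 4 18` (stmt-ValiantsHypothesis-19980), asserted nowhere; fourth and last kernel file of this seat's chain
«Rolle twists ⇒ Descartes-sharp sub-word ⇒ closed-form necessary condition».  g8's …SheetTwistedBlocks made the TOP trinomial `{3,3,j}` of a null-top eighteen
explicit (`Census.topTrinomial_ineq_of_nullTop_eighteen`); here the same is done for EVERY letter `k` — the three slots `{k,k,p}, {k,k,q}, {k,k,r}` (`p, q, r` the other
letters, `d_q = d_p + a`, `d_r = d_q + b`, `a, b ≥ 1`) have exponents `2d_k + d_p + (0, a, a+b)`, a TRINOMIAL window — for a full-support NINETEEN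
(`Census.twistedSubword_sharp_of_nineteen`) and for a null-top EIGHTEEN (`Census.twistedSubword_sharp_of_nullTop_eighteen`; the absent slot `{3,3,3}` is never one of
the three since `j ≠ k`):

* **`twistedLetterTrinomial_ineq_of_nineteen`** — `19` distinct positive roots, any real letters, any `d` ⇒ with `W(n) = ∏ (n − σ(u))` over the exponents of the
  seventeen other slots and `c̃_j = W(2d_k+d_j)·coeff(2d_k+d_j)`: `(a+b)^{a+b}·|c̃_p|^b·|c̃_r|^a ≤ |c̃_q|^{a+b}·aᵃ·bᵇ` (weighted AM–GM at the two roots,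
  `Census.trinomial_two_posRoots_le`) — the middle coefficient of every twisted letter trinomial DOMINATES;
* `letterTrinomial_coeffs_eq_traces_of_nineteen` — `coeff(2d_k + d_j) = tr(adj S_k·S_j)` (`Census.coeff_det_pencil_three_square` + `square_unique_of_nineteen`);
* **`posRoots_le_18_of_twistedLetterTrinomial_lt`** — THE DOOR CERTIFICATE: if for some letter `k` the strict reverse inequality
  `|W_q·tr(adj S_k·S_q)|^{a+b}·aᵃ·bᵇ < (a+b)^{a+b}·|W_p·tr(adj S_k·S_p)|^b·|W_r·tr(adj S_k·S_r)|^a` holds (letter data and `d` only), the pencil has at most `18`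
  distinct positive roots — a closed neighbourhood of each hyperplane `{tr(adj S_k·S_q) = 0}` carries no nineteen, quantitatively;
* **`sheetLetterTrinomial_ineq_of_nullTop_eighteen`**, `sheetLetterTrinomial_coeffs_eq_traces_of_nullTop_eighteen`,
  **`posRoots_le_17_of_nullTop_of_twistedLetterTrinomial_lt`** — the same on the null-top sheet (sorted support, `det S₃ = 0`, `18` roots; `W` over the sixteen other
  sheet slots), for every letter `k` (for `k = 3` this is g8's row in the present bookkeeping).

LOCATED COMPANION (this seat, exact; report HOME/DOOR-A34-ENG2G12-REPORT.md §3, tool work/census_tri.py): over the `(3,4)` census of record the AM–GM margins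
`log₁₀(RHS/LHS)` of the four twisted letter trinomials are large (tens to hundreds of decades) EXCEPT the top trinomial `k = 3` on the pseudo-nineteen rail
`(0,2,5,N)` / `(0,3,7,N)`, where the margin is `+0.02 … +0.03` (a factor `1.05–1.07` from the certified region: the twisted top window's two roots are nearly a
double root); the general real nineteen `G3K4E1` passes with margins `0.7 … 2.5`.

Nothing here bounds `ζ_sym(3,4)`; `DoorA34` and the three stubs stay OPEN; registers unchanged (`ζ_sym(3,4) ∈ {18,19}`); nothing on `MatrixDescartes`
(stmt-ValiantsHypothesis-18050) or on `VP ≠ VNP` — VP≠VNP not moved.  [folklore] Rolle twists + Descartes sharpness + weighted AM–GM; no single source.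
-/

-- `Summit.ValiantsHypothesis.ValiantsHypothesis.…` repeats a component by the D-0017 layout
-- (single-conjunct summit), which the `dupNamespace` linter flags; the name is mandated.
set_option linter.dupNamespace false

namespace Summit.ValiantsHypothesis.ValiantsHypothesis.Theorems.LacunarySymmetroidMatrixDescartes.Census

open Polynomial Finset
open scoped BigOperators Polynomial Matrix

/-! ## 1. The door: twisted letter trinomials of a nineteen -/

/-- **TWISTED LETTER TRINOMIAL INEQUALITY OF A NINETEEN.**  Any real `3 × 3` letters, any `d`; letters `k, p, q, r` with `k ≠ p, q, r`, `d_q = d_p + a`,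
`d_r = d_q + b`, `0 < a`, `0 < b`; `19` distinct positive roots.  With `W(n) = ∏ (n − σ(u))` over the exponents of the seventeen slots other than
`{k,k,p}, {k,k,q}, {k,k,r}` and `c̃_j = W(2d_k + d_j)·coeff(2d_k + d_j)`: `(a+b)^{a+b}·|c̃_p|^b·|c̃_r|^a ≤ |c̃_q|^{a+b}·aᵃ·bᵇ`. [folklore] -/
theorem twistedLetterTrinomial_ineq_of_nineteen (d : Fin 4 → ℕ) (S : Fin 4 → Matrix (Fin 3) (Fin 3) ℝ)
    (h19 : 19 ≤ ((Matrix.det (∑ l, ((X : ℝ[X]) ^ d l) • (S l).map C)).roots.toFinset.filter (fun t => 0 < t)).card)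
    (k p q r : Fin 4) {a b : ℕ} (ha : d q = d p + a) (hb : d r = d q + b) (ha0 : 0 < a) (hb0 : 0 < b)
    (W : ℕ → ℝ) (hW : ∀ n, W n =
      ∏ E ∈ (((Finset.univ : Finset (Sym (Fin 4) 3)) \
          ({⟨{k, k, p}, by simp⟩, ⟨{k, k, q}, by simp⟩, ⟨{k, k, r}, by simp⟩} : Finset (Sym (Fin 4) 3))).image
          (fun s : Sym (Fin 4) 3 => ((s : Multiset (Fin 4)).map d).sum)).image (fun m : ℕ => (m : ℝ)), ((n : ℝ) - E))
    (c₀ c₁ c₂ : ℝ)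
    (hc₀ : c₀ = W (2 * d k + d p) * (Matrix.det (∑ l, ((X : ℝ[X]) ^ d l) • (S l).map C)).coeff (2 * d k + d p))
    (hc₁ : c₁ = W (2 * d k + d q) * (Matrix.det (∑ l, ((X : ℝ[X]) ^ d l) • (S l).map C)).coeff (2 * d k + d q))
    (hc₂ : c₂ = W (2 * d k + d r) * (Matrix.det (∑ l, ((X : ℝ[X]) ^ d l) • (S l).map C)).coeff (2 * d k + d r)) :
    ((a : ℝ) + b) ^ (a + b) * |c₀| ^ b * |c₂| ^ a ≤ |c₁| ^ (a + b) * (a : ℝ) ^ a * (b : ℝ) ^ b := by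
  set B : Finset (Sym (Fin 4) 3) := {⟨{k, k, p}, by simp⟩, ⟨{k, k, q}, by simp⟩, ⟨{k, k, r}, by simp⟩} with hB
  obtain ⟨g, hg, hsupp, hZ⟩ := twistedSubword_sharp_of_nineteen d S h19 B ⟨_, Finset.mem_insert_self _ _⟩
  have hmemB : ∀ n ∈ g.support, n = 2 * d k + d p ∨ n = 2 * d k + d q ∨ n = 2 * d k + d r := by
    intro n hn
    have h := hsupp hn
    rw [hB] at h
    simp only [Finset.image_insert, Finset.image_singleton, Finset.mem_insert, Finset.mem_singleton, Sym.coe_mk,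
      Multiset.insert_eq_cons, Multiset.map_cons, Multiset.sum_cons, Multiset.map_singleton, Multiset.sum_singleton] at h
    omega
  have h3 : 3 ≤ B.card := by
    have hsub : ({2 * d k + d p, 2 * d k + d q, 2 * d k + d r} : Finset ℕ)
        ⊆ B.image (fun s : Sym (Fin 4) 3 => ((s : Multiset (Fin 4)).map d).sum) := by
      intro n hn
      rw [hB]
      simp only [Finset.image_insert, Finset.image_singleton, Finset.mem_insert, Finset.mem_singleton, Sym.coe_mk,
        Multiset.insert_eq_cons, Multiset.map_cons, Multiset.sum_cons, Multiset.map_singleton, Multiset.sum_singleton]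
      simp only [Finset.mem_insert, Finset.mem_singleton] at hn
      omega
    have hc : ({2 * d k + d p, 2 * d k + d q, 2 * d k + d r} : Finset ℕ).card = 3 := by
      rw [Finset.card_insert_of_notMem, Finset.card_insert_of_notMem, Finset.card_singleton] <;>
        simp only [Finset.mem_insert, Finset.mem_singleton] <;> omega
    calc 3 = _ := hc.symm
      _ ≤ (B.image (fun s : Sym (Fin 4) 3 => ((s : Multiset (Fin 4)).map d).sum)).card := Finset.card_le_card hsub
      _ ≤ B.card := Finset.card_image_le
  have hcoef : ∀ n, g.coeff n = W n * (Matrix.det (∑ l, ((X : ℝ[X]) ^ d l) • (S l).map C)).coeff n := by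
    intro n; rw [hg, hW]
  have e1 : 2 * d k + d q = 2 * d k + d p + a := by omega
  have e2 : 2 * d k + d r = 2 * d k + d p + a + b := by omega
  have hgeq : g = C c₀ * X ^ (2 * d k + d p) + C c₁ * X ^ (2 * d k + d p + a) + C c₂ * X ^ (2 * d k + d p + a + b) := by
    ext n
    simp only [coeff_add, coeff_C_mul, coeff_X_pow]
    by_cases h0 : n = 2 * d k + d p
    · subst h0
      rw [hcoef, ← hc₀, if_pos rfl, if_neg (by omega), if_neg (by omega)]
      ring
    by_cases h1 : n = 2 * d k + d p + a
    · subst h1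
      rw [hcoef, ← e1, ← hc₁, if_neg (by omega), e1, if_pos rfl, if_neg (by omega)]
      ring
    by_cases h2 : n = 2 * d k + d p + a + b
    · subst h2
      rw [hcoef, ← e2, ← hc₂, if_neg (by omega), if_neg (by omega), e2, if_pos rfl]
      ring
    have hn : n ∉ g.support := fun hn => by
      rcases hmemB n hn with h | h | h <;> omega
    rw [notMem_support_iff.mp hn, if_neg h0, if_neg h1, if_neg h2]
    ring
  have h2 : 1 < ((C c₀ * X ^ (2 * d k + d p) + C c₁ * X ^ (2 * d k + d p + a)
      + C c₂ * X ^ (2 * d k + d p + a + b)).roots.toFinset.filter (fun x => 0 < x)).card := by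
    rw [← hgeq]; omega
  exact trinomial_two_posRoots_le ha0 hb0 _ _ _ h2

/-- **Letter trinomial coefficients of a nineteen**: `coeff(2d_k + d_j) = tr(adj S_k·S_j)` for `j ≠ k` (the `20` slot sums are distinct). [folklore] -/
theorem letterTrinomial_coeffs_eq_traces_of_nineteen (d : Fin 4 → ℕ) (S : Fin 4 → Matrix (Fin 3) (Fin 3) ℝ)
    (h19 : 19 ≤ ((Matrix.det (∑ l, ((X : ℝ[X]) ^ d l) • (S l).map C)).roots.toFinset.filter (fun t => 0 < t)).card)
    (k p q r : Fin 4) (hkp : k ≠ p) (hkq : k ≠ q) (hkr : k ≠ r) :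
    (Matrix.det (∑ l, ((X : ℝ[X]) ^ d l) • (S l).map C)).coeff (2 * d k + d p) = ((S k).adjugate * S p).trace
      ∧ (Matrix.det (∑ l, ((X : ℝ[X]) ^ d l) • (S l).map C)).coeff (2 * d k + d q) = ((S k).adjugate * S q).trace
      ∧ (Matrix.det (∑ l, ((X : ℝ[X]) ^ d l) • (S l).map C)).coeff (2 * d k + d r) = ((S k).adjugate * S r).trace :=
  ⟨coeff_det_pencil_three_square d S hkp (square_unique_of_nineteen d S h19 hkp),
    coeff_det_pencil_three_square d S hkq (square_unique_of_nineteen d S h19 hkq),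
    coeff_det_pencil_three_square d S hkr (square_unique_of_nineteen d S h19 hkr)⟩

/-- **DOOR CERTIFICATE (twisted letter trinomial).**  Any real `3 × 3` letters, any `d`, `k ≠ p, q, r`, `d_q = d_p + a`, `d_r = d_q + b`, `a, b ≥ 1`,
`W` as above, `c̃_j = W(2d_k + d_j)·tr(adj S_k·S_j)`.  If `|c̃_q|^{a+b}·aᵃ·bᵇ < (a+b)^{a+b}·|c̃_p|^b·|c̃_r|^a` then the pencil has at most `18` distinct positive roots.
[folklore] -/
theorem posRoots_le_18_of_twistedLetterTrinomial_lt (d : Fin 4 → ℕ) (S : Fin 4 → Matrix (Fin 3) (Fin 3) ℝ)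
    (k p q r : Fin 4) (hkp : k ≠ p) (hkq : k ≠ q) (hkr : k ≠ r) {a b : ℕ} (ha : d q = d p + a) (hb : d r = d q + b) (ha0 : 0 < a) (hb0 : 0 < b)
    (W : ℕ → ℝ) (hW : ∀ n, W n =
      ∏ E ∈ (((Finset.univ : Finset (Sym (Fin 4) 3)) \
          ({⟨{k, k, p}, by simp⟩, ⟨{k, k, q}, by simp⟩, ⟨{k, k, r}, by simp⟩} : Finset (Sym (Fin 4) 3))).image
          (fun s : Sym (Fin 4) 3 => ((s : Multiset (Fin 4)).map d).sum)).image (fun m : ℕ => (m : ℝ)), ((n : ℝ) - E))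
    (c₀ c₁ c₂ : ℝ)
    (hc₀ : c₀ = W (2 * d k + d p) * ((S k).adjugate * S p).trace)
    (hc₁ : c₁ = W (2 * d k + d q) * ((S k).adjugate * S q).trace)
    (hc₂ : c₂ = W (2 * d k + d r) * ((S k).adjugate * S r).trace)
    (hlt : |c₁| ^ (a + b) * (a : ℝ) ^ a * (b : ℝ) ^ b < ((a : ℝ) + b) ^ (a + b) * |c₀| ^ b * |c₂| ^ a) :
    ((Matrix.det (∑ l, ((X : ℝ[X]) ^ d l) • (S l).map C)).roots.toFinset.filter (fun t => 0 < t)).card ≤ 18 := by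
  by_contra hle
  have h19 : 19 ≤ ((Matrix.det (∑ l, ((X : ℝ[X]) ^ d l) • (S l).map C)).roots.toFinset.filter (fun t => 0 < t)).card := by omega
  obtain ⟨e0, e1, e2⟩ := letterTrinomial_coeffs_eq_traces_of_nineteen d S h19 k p q r hkp hkq hkr
  have h := twistedLetterTrinomial_ineq_of_nineteen d S h19 k p q r ha hb ha0 hb0 W hW c₀ c₁ c₂
    (by rw [e0]; exact hc₀) (by rw [e1]; exact hc₁) (by rw [e2]; exact hc₂)
  linarith

/-! ## 2. The sheet: twisted letter trinomials of a null-top eighteen -/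

/-- **TWISTED LETTER TRINOMIAL INEQUALITY OF A NULL-TOP EIGHTEEN.**  Any real letters, any `d`, `det S₃ = 0`, `18` distinct positive roots; letters `k ≠ p, q, r` with
`d_q = d_p + a`, `d_r = d_q + b`, `a, b ≥ 1`.  With `W(n) = ∏ (n − σ(u))` over the exponents of the SIXTEEN other sheet slots (`u ≠ {3,3,3}`) and
`c̃_j = W(2d_k + d_j)·coeff(2d_k + d_j)`: `(a+b)^{a+b}·|c̃_p|^b·|c̃_r|^a ≤ |c̃_q|^{a+b}·aᵃ·bᵇ`.  (For `k = 3` compare `Census.topTrinomial_ineq_of_nullTop_eighteen`.)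
[folklore] -/
theorem sheetLetterTrinomial_ineq_of_nullTop_eighteen (d : Fin 4 → ℕ) (S : Fin 4 → Matrix (Fin 3) (Fin 3) ℝ) (h3 : (S 3).det = 0)
    (h18 : 18 ≤ ((Matrix.det (∑ l, ((X : ℝ[X]) ^ d l) • (S l).map C)).roots.toFinset.filter (fun t => 0 < t)).card)
    (k p q r : Fin 4) (hkp : k ≠ p) (hkq : k ≠ q) (hkr : k ≠ r) {a b : ℕ} (ha : d q = d p + a) (hb : d r = d q + b)
    (ha0 : 0 < a) (hb0 : 0 < b)
    (W : ℕ → ℝ) (hW : ∀ n, W n =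
      ∏ E ∈ ((((Finset.univ : Finset (Sym (Fin 4) 3)).erase (Sym.replicate 3 3)) \
          ({⟨{k, k, p}, by simp⟩, ⟨{k, k, q}, by simp⟩, ⟨{k, k, r}, by simp⟩} : Finset (Sym (Fin 4) 3))).image
          (fun s : Sym (Fin 4) 3 => ((s : Multiset (Fin 4)).map d).sum)).image (fun m : ℕ => (m : ℝ)), ((n : ℝ) - E))
    (c₀ c₁ c₂ : ℝ)
    (hc₀ : c₀ = W (2 * d k + d p) * (Matrix.det (∑ l, ((X : ℝ[X]) ^ d l) • (S l).map C)).coeff (2 * d k + d p))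
    (hc₁ : c₁ = W (2 * d k + d q) * (Matrix.det (∑ l, ((X : ℝ[X]) ^ d l) • (S l).map C)).coeff (2 * d k + d q))
    (hc₂ : c₂ = W (2 * d k + d r) * (Matrix.det (∑ l, ((X : ℝ[X]) ^ d l) • (S l).map C)).coeff (2 * d k + d r)) :
    ((a : ℝ) + b) ^ (a + b) * |c₀| ^ b * |c₂| ^ a ≤ |c₁| ^ (a + b) * (a : ℝ) ^ a * (b : ℝ) ^ b := by
  set B : Finset (Sym (Fin 4) 3) := {⟨{k, k, p}, by simp⟩, ⟨{k, k, q}, by simp⟩, ⟨{k, k, r}, by simp⟩} with hB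
  have hBsub : B ⊆ (Finset.univ : Finset (Sym (Fin 4) 3)).erase (Sym.replicate 3 3) := by
    intro s hs
    rw [Finset.mem_erase]
    refine ⟨?_, Finset.mem_univ _⟩
    rw [hB] at hs
    simp only [Finset.mem_insert, Finset.mem_singleton] at hs
    have key : ∀ (j : Fin 4) (hkj : k ≠ j) (hm : Multiset.card ({k, k, j} : Multiset (Fin 4)) = 3),
        (⟨{k, k, j}, hm⟩ : Sym (Fin 4) 3) ≠ Sym.replicate 3 3 := by
      intro j hkj hm e
      have hm3 : ({k, k, j} : Multiset (Fin 4)) = Multiset.replicate 3 (3 : Fin 4) := by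
        simpa [Sym.coe_replicate] using congrArg (fun u : Sym (Fin 4) 3 => (u : Multiset (Fin 4))) e
      have hk3 : k = 3 := Multiset.eq_of_mem_replicate (show k ∈ Multiset.replicate 3 (3 : Fin 4) by rw [← hm3]; simp)
      have hj3 : j = 3 := Multiset.eq_of_mem_replicate (show j ∈ Multiset.replicate 3 (3 : Fin 4) by rw [← hm3]; simp)
      exact hkj (hk3.trans hj3.symm)
    rcases hs with rfl | rfl | rfl
    · exact key p hkp _
    · exact key q hkq _
    · exact key r hkr _
  obtain ⟨g, hg, hsupp, hZ⟩ := twistedSubword_sharp_of_nullTop_eighteen d S h3 h18 B hBsub ⟨_, Finset.mem_insert_self _ _⟩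
  have hmemB : ∀ n ∈ g.support, n = 2 * d k + d p ∨ n = 2 * d k + d q ∨ n = 2 * d k + d r := by
    intro n hn
    have h := hsupp hn
    rw [hB] at h
    simp only [Finset.image_insert, Finset.image_singleton, Finset.mem_insert, Finset.mem_singleton, Sym.coe_mk,
      Multiset.insert_eq_cons, Multiset.map_cons, Multiset.sum_cons, Multiset.map_singleton, Multiset.sum_singleton] at h
    omega
  have h3' : 3 ≤ B.card := by
    have hsub : ({2 * d k + d p, 2 * d k + d q, 2 * d k + d r} : Finset ℕ)
        ⊆ B.image (fun s : Sym (Fin 4) 3 => ((s : Multiset (Fin 4)).map d).sum) := by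
      intro n hn
      rw [hB]
      simp only [Finset.image_insert, Finset.image_singleton, Finset.mem_insert, Finset.mem_singleton, Sym.coe_mk,
        Multiset.insert_eq_cons, Multiset.map_cons, Multiset.sum_cons, Multiset.map_singleton, Multiset.sum_singleton]
      simp only [Finset.mem_insert, Finset.mem_singleton] at hn
      omega
    have hc : ({2 * d k + d p, 2 * d k + d q, 2 * d k + d r} : Finset ℕ).card = 3 := by
      rw [Finset.card_insert_of_notMem, Finset.card_insert_of_notMem, Finset.card_singleton] <;>
        simp only [Finset.mem_insert, Finset.mem_singleton] <;> omega
    calc 3 = _ := hc.symm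
      _ ≤ (B.image (fun s : Sym (Fin 4) 3 => ((s : Multiset (Fin 4)).map d).sum)).card := Finset.card_le_card hsub
      _ ≤ B.card := Finset.card_image_le
  have hcoef : ∀ n, g.coeff n = W n * (Matrix.det (∑ l, ((X : ℝ[X]) ^ d l) • (S l).map C)).coeff n := by
    intro n; rw [hg, hW]
  have e1 : 2 * d k + d q = 2 * d k + d p + a := by omega
  have e2 : 2 * d k + d r = 2 * d k + d p + a + b := by omega
  have hgeq : g = C c₀ * X ^ (2 * d k + d p) + C c₁ * X ^ (2 * d k + d p + a) + C c₂ * X ^ (2 * d k + d p + a + b) := by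
    ext n
    simp only [coeff_add, coeff_C_mul, coeff_X_pow]
    by_cases h0 : n = 2 * d k + d p
    · subst h0
      rw [hcoef, ← hc₀, if_pos rfl, if_neg (by omega), if_neg (by omega)]
      ring
    by_cases h1 : n = 2 * d k + d p + a
    · subst h1
      rw [hcoef, ← e1, ← hc₁, if_neg (by omega), e1, if_pos rfl, if_neg (by omega)]
      ring
    by_cases h2 : n = 2 * d k + d p + a + b
    · subst h2
      rw [hcoef, ← e2, ← hc₂, if_neg (by omega), if_neg (by omega), e2, if_pos rfl]
      ring
    have hn : n ∉ g.support := fun hn => by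
      rcases hmemB n hn with h | h | h <;> omega
    rw [notMem_support_iff.mp hn, if_neg h0, if_neg h1, if_neg h2]
    ring
  have h2 : 1 < ((C c₀ * X ^ (2 * d k + d p) + C c₁ * X ^ (2 * d k + d p + a)
      + C c₂ * X ^ (2 * d k + d p + a + b)).roots.toFinset.filter (fun x => 0 < x)).card := by
    rw [← hgeq]; omega
  exact trinomial_two_posRoots_le ha0 hb0 _ _ _ h2

/-- **Letter trinomial coefficients of a null-top eighteen** (sorted support): `coeff(2d_k + d_j) = tr(adj S_k·S_j)`, `j ≠ k`. [folklore] -/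
theorem sheetLetterTrinomial_coeffs_eq_traces_of_nullTop_eighteen (d : Fin 4 → ℕ) (hd : StrictMono d) (S : Fin 4 → Matrix (Fin 3) (Fin 3) ℝ)
    (h3 : (S 3).det = 0)
    (h18 : 18 ≤ ((Matrix.det (∑ l, ((X : ℝ[X]) ^ d l) • (S l).map C)).roots.toFinset.filter (fun t => 0 < t)).card)
    (k p q r : Fin 4) (hkp : k ≠ p) (hkq : k ≠ q) (hkr : k ≠ r) :
    (Matrix.det (∑ l, ((X : ℝ[X]) ^ d l) • (S l).map C)).coeff (2 * d k + d p) = ((S k).adjugate * S p).trace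
      ∧ (Matrix.det (∑ l, ((X : ℝ[X]) ^ d l) • (S l).map C)).coeff (2 * d k + d q) = ((S k).adjugate * S q).trace
      ∧ (Matrix.det (∑ l, ((X : ℝ[X]) ^ d l) • (S l).map C)).coeff (2 * d k + d r) = ((S k).adjugate * S r).trace :=
  ⟨(coeff_square_of_nullTop_eighteen d hd S h3 h18 k p hkp).1, (coeff_square_of_nullTop_eighteen d hd S h3 h18 k q hkq).1,
    (coeff_square_of_nullTop_eighteen d hd S h3 h18 k r hkr).1⟩

/-- **SHEET CERTIFICATE (twisted letter trinomial).**  Sorted support, any real letters, `det S₃ = 0`, `k ≠ p, q, r`, `d_q = d_p + a`, `d_r = d_q + b`, `a, b ≥ 1`,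
`W` over the sixteen other sheet slots, `c̃_j = W(2d_k + d_j)·tr(adj S_k·S_j)`.  If `|c̃_q|^{a+b}·aᵃ·bᵇ < (a+b)^{a+b}·|c̃_p|^b·|c̃_r|^a` then at most `17` distinct positive
roots. [folklore] -/
theorem posRoots_le_17_of_nullTop_of_twistedLetterTrinomial_lt (d : Fin 4 → ℕ) (hd : StrictMono d) (S : Fin 4 → Matrix (Fin 3) (Fin 3) ℝ)
    (h3 : (S 3).det = 0)
    (k p q r : Fin 4) (hkp : k ≠ p) (hkq : k ≠ q) (hkr : k ≠ r) {a b : ℕ} (ha : d q = d p + a) (hb : d r = d q + b) (ha0 : 0 < a) (hb0 : 0 < b)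
    (W : ℕ → ℝ) (hW : ∀ n, W n =
      ∏ E ∈ ((((Finset.univ : Finset (Sym (Fin 4) 3)).erase (Sym.replicate 3 3)) \
          ({⟨{k, k, p}, by simp⟩, ⟨{k, k, q}, by simp⟩, ⟨{k, k, r}, by simp⟩} : Finset (Sym (Fin 4) 3))).image
          (fun s : Sym (Fin 4) 3 => ((s : Multiset (Fin 4)).map d).sum)).image (fun m : ℕ => (m : ℝ)), ((n : ℝ) - E))
    (c₀ c₁ c₂ : ℝ)
    (hc₀ : c₀ = W (2 * d k + d p) * ((S k).adjugate * S p).trace)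
    (hc₁ : c₁ = W (2 * d k + d q) * ((S k).adjugate * S q).trace)
    (hc₂ : c₂ = W (2 * d k + d r) * ((S k).adjugate * S r).trace)
    (hlt : |c₁| ^ (a + b) * (a : ℝ) ^ a * (b : ℝ) ^ b < ((a : ℝ) + b) ^ (a + b) * |c₀| ^ b * |c₂| ^ a) :
    ((Matrix.det (∑ l, ((X : ℝ[X]) ^ d l) • (S l).map C)).roots.toFinset.filter (fun t => 0 < t)).card ≤ 17 := by
  by_contra hle
  have h18 : 18 ≤ ((Matrix.det (∑ l, ((X : ℝ[X]) ^ d l) • (S l).map C)).roots.toFinset.filter (fun t => 0 < t)).card := by omega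
  obtain ⟨e0, e1, e2⟩ := sheetLetterTrinomial_coeffs_eq_traces_of_nullTop_eighteen d hd S h3 h18 k p q r hkp hkq hkr
  have h := sheetLetterTrinomial_ineq_of_nullTop_eighteen d S h3 h18 k p q r hkp hkq hkr ha hb ha0 hb0 W hW c₀ c₁ c₂
    (by rw [e0]; exact hc₀) (by rw [e1]; exact hc₁) (by rw [e2]; exact hc₂)
  linarith

end Summit.ValiantsHypothesis.ValiantsHypothesis.Theorems.LacunarySymmetroidMatrixDescartes.Census
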